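import Literature.AlgebraicGeometry.GroupSchemes.HomEqualityLocusFiniteFlat
import Literature.AlgebraicGeometry.GroupSchemes.GroupSchemeActionOfPoints
import Literature.AlgebraicGeometry.GroupSchemes.GroupSchemeActionStabilizer
import HarnessLib

/-!
# The kernel of a group-scheme action on a finite flat scheme is a closed subgroup functor

Topic `Literature/AlgebraicGeometry/GroupSchemes`; theorems only (no definition, no named fact, no instance, no notation,
no `sorry`).  Cell hodgecm-mathlib, F-DAG (h6) (iii)+ (B-plan1 (g15) 05:57:27Z 2026-08-30), in the currency of ★
`GroupSchemes/HomEqualityLocusFiniteFlat` (W1 «`φ = ψ` is closed»), ★ `GroupSchemes/FixedLocusFiniteFlat` (fixed locus of a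
section), ★ `GroupSchemes/KernelLocusFiniteFlat` (`Ker φ`), ★ `GroupSchemes/GroupSchemeActionStabilizer` (`Stab(x)`), over the
finite-flat containment road ★ `Morphisms/ContainmentLocusFiniteFlat` + ★ `Morphisms/EqualizerLocusClosed`.  HC_CM is proved
only modulo the 7 printed citations until rung 0 closes; nothing here is about HC.

Setting: an action `γ[G, X] : G ⊗ X ⟶ X` of a monoid/group object `G` on `X` (Mathlib `[MonObj G] [ModObj G X]`; for schemes
`G X : Over S`, [GortzWedhorn2020] Definition 4.44, [MumfordFogartyKirwan1994] Ch. 0 §1 Def. 0.3), read on `T`-valued points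
as `g • x = ⟨g, x⟩ ≫ γ` (★ `GroupSchemeActionOfPoints`).  A `T`-valued point `g : T ⟶ G` **acts trivially** when
`(t ≫ g) • x = x` for every `t : T' ⟶ T` and every `x : T' ⟶ X` («`g` acts as the identity on `X_T`»); these points form the
KERNEL of the action, a sub-presheaf of normal subgroups `N(T) ⊴ G(T)` — the kernel of the homomorphism of group functors
`G → Aut(X)`, i.e. the intersection of all stabilizers ([MumfordFogartyKirwan1994] Ch. 0 §1 Def. 0.4: `S(x) = {g | g · x = x}`).

* §1 (any cartesian monoidal category) **the kernel sub-presheaf**: `whiskerRight_smul_eq_snd_iff_forall_smul_eq` (one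
  universal point: `g` acts trivially iff `g ▷ X ≫ γ = pr₂`), `forall_smul_eq_comp` (presheaf in `T`), `forall_one_smul_eq`,
  `forall_mul_smul_eq`, `forall_inv_smul_eq`, `forall_conj_smul_eq` (a normal subgroup of `G(T)`), `smul_eq_snd_iff_forall_smul_eq`;
* §2 (schemes, `G X : Over S`) **the kernel is a closed subscheme of `G`** when `X ⟶ S` is FINITE, FLAT (over a locally
  noetherian `G`; or `pr₁ : G ×_S X ⟶ G` affine with finite projective affine charts, any base) and SEPARATED: the universal
  stabilizer `Eq(γ, pr₂) ⊆ G ×_S X` is closed ([GortzWedhorn2020] Def./Prop. 9.7 (ii)), `g` acts trivially iff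
  `(G ×_S X) ×_G T ⟶ G ×_S X` factors through it (`fst_comp_smul_left_eq_iff_forall_smul_eq`,
  `ker_equalizer_ι_le_ker_fst_iff_forall_smul_eq`), and ★ `ContainmentLocusFiniteFlat` pushed down the finite flat `pr₁` gives ONE
  ideal sheaf `N` on `G` with **`N ≤ g.left.ker ↔ g acts trivially ↔ g factors through V(N)`** for every `S`-scheme `T` and
  every `g : T ⟶ G` (`exists_idealSheafData_le_ker_iff_forall_smul_eq_of_isFinite_of_flat`, `…_of_locallyOfFiniteType`,
  `…_of_finite_projective_app`); uniqueness (`idealSheafData_eq_of_le_ker_iff_forall_smul_eq`), normal subgroup in the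
  `N ≤ (·).left.ker` currency (`le_ker_one_left`, `le_ker_mul_left`, `le_ker_comp_left`, `le_ker_inv_left`, `le_ker_conj_left`),
  `V(N) ⊆ Stab(x)` for every section (`ker_stabι_le`), trivial action iff `N = ⊥` (`smul_eq_snd_iff_eq_bot`);
* §3 **base form**: «`G_T` acts trivially on `X_T`» is a closed subscheme of `S` for `G`, `X` finite flat over a locally
  noetherian `S`, `X/S` separated (`exists_idealSheafData_iff_forall_smul_eq_of_isFinite_of_flat`; ★ W1 at `γ` vs `pr₂`, read on
  points by `pullback_map_eq_iff_forall_comp_eq`) ([MumfordFogartyKirwan1994] Ch. 6 §3 Prop. 6.16).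

## References
* [GortzWedhorn2020] U. Görtz, T. Wedhorn, *Algebraic Geometry I: Schemes*, 2nd ed. (2020): Definition 4.44 (p. 117) (action
  of a group scheme on `T`-valued points), Definition/Proposition 9.7 (ii) (equalisers into separated schemes are closed),
  Definition 12.18 and Proposition 12.19 (pp. 331–332) (finite locally free morphisms), Section (4.7) (pp. 107–108) (base change).
* [MumfordFogartyKirwan1994] D. Mumford, J. Fogarty, F. Kirwan, *Geometric Invariant Theory*, 3rd ed. (1994), Ch. 0 §1,
  Def. 0.3 and Def. 0.4 (p. 3) (actions, the stabilizer `S(x)` as a fibre product), Ch. 6 §3 Prop. 6.16 (p. 126) (closed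
  conditions on the base).
-/

noncomputable section
-- `TopCat.Presheaf`/`Scheme.Modules` are not reducible (as in Mathlib's `AlgebraicGeometry/Modules`).
set_option backward.isDefEq.respectTransparency false

open CategoryTheory CategoryTheory.Limits AlgebraicGeometry MonoidalCategory CartesianMonoidalCategory

universe v u

namespace Literature.AlgebraicGeometry.GroupSchemes

open Stabilizer Literature.AlgebraicGeometry.Morphisms
open scoped MonObj

/-! ## §1 The kernel of an action, on `T`-valued points (any cartesian monoidal category) -/

section Points

variable {C : Type u} [Category.{v} C] [CartesianMonoidalCategory C] (G X : C)

section Mon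

variable [MonObj G] [ModObj G X]

/-- **One universal point suffices**: a `T`-valued point `g : T ⟶ G` acts trivially on `X_T` — `(t ≫ g) • x = x` for all
`t : T' ⟶ T`, `x : T' ⟶ X` — iff `g ▷ X ≫ γ = pr₂ : T ⊗ X ⟶ X` (test it on the universal point `(pr₁ ≫ g, pr₂)` of `T ⊗ X`).
[cite: GortzWedhorn2020, Definition 4.44, p. 117] -/
theorem whiskerRight_smul_eq_snd_iff_forall_smul_eq {T : C} (g : T ⟶ G) :
    g ▷ X ≫ γ[G, X] = snd T X ↔ ∀ ⦃T' : C⦄ (t : T' ⟶ T) (x : T' ⟶ X), (t ≫ g) • x = x := by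
  constructor
  · intro h T' t x
    rw [smul_eq_lift_comp, ← lift_whiskerRight, Category.assoc, h, lift_snd]
  · intro h
    have hw : g ▷ X = lift (fst T X ≫ g) (snd T X) := by
      apply CartesianMonoidalCategory.hom_ext <;> simp
    rw [hw, ← smul_eq_lift_comp]
    exact h (fst T X) (snd T X)

/-- **The kernel is a sub-presheaf of `G`**: if `g : T ⟶ G` acts trivially then so does `s ≫ g` for every `s : T'' ⟶ T`.
[cite: GortzWedhorn2020, Definition 4.44, p. 117] -/
theorem forall_smul_eq_comp {T T'' : C} {g : T ⟶ G}
    (hg : ∀ ⦃T' : C⦄ (t : T' ⟶ T) (x : T' ⟶ X), (t ≫ g) • x = x) (s : T'' ⟶ T) :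
    ∀ ⦃T' : C⦄ (t : T' ⟶ T'') (x : T' ⟶ X), (t ≫ (s ≫ g)) • x = x :=
  fun _ t x => by rw [← Category.assoc]; exact hg (t ≫ s) x

/-- The unit `1 : T ⟶ G` acts trivially. [cite: GortzWedhorn2020, Definition 4.44, p. 117] -/
theorem forall_one_smul_eq (T : C) :
    ∀ ⦃T' : C⦄ (t : T' ⟶ T) (x : T' ⟶ X), (t ≫ (1 : T ⟶ G)) • x = x :=
  fun _ t x => by rw [MonObj.comp_one, one_smul]

/-- **The kernel is closed under multiplication** in `G(T)`. [cite: GortzWedhorn2020, Definition 4.44, p. 117] -/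
theorem forall_mul_smul_eq {T : C} {g h : T ⟶ G}
    (hg : ∀ ⦃T' : C⦄ (t : T' ⟶ T) (x : T' ⟶ X), (t ≫ g) • x = x)
    (hh : ∀ ⦃T' : C⦄ (t : T' ⟶ T) (x : T' ⟶ X), (t ≫ h) • x = x) :
    ∀ ⦃T' : C⦄ (t : T' ⟶ T) (x : T' ⟶ X), (t ≫ (g * h)) • x = x :=
  fun _ t x => by rw [MonObj.comp_mul, mul_smul, hh, hg]

/-- **The action is trivial (`γ = pr₂`) iff every `T`-valued point acts trivially** (Yoneda at `G ⊗ X`).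
[cite: GortzWedhorn2020, Definition 4.44, p. 117] -/
theorem smul_eq_snd_iff_forall_smul_eq :
    γ[G, X] = snd G X ↔ ∀ ⦃T : C⦄ (g : T ⟶ G) (x : T ⟶ X), g • x = x := by
  constructor
  · intro h T g x
    rw [smul_eq_lift_comp, h, lift_snd]
  · intro h
    have h1 := h (fst G X) (snd G X)
    rwa [smul_eq_lift_comp, lift_fst_snd, Category.id_comp] at h1

end Mon

section Grp

variable [GrpObj G] [ModObj G X]

/-- **The kernel is closed under inverses** in `G(T)`. [cite: GortzWedhorn2020, Definition 4.44, p. 117] -/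
theorem forall_inv_smul_eq {T : C} {g : T ⟶ G}
    (hg : ∀ ⦃T' : C⦄ (t : T' ⟶ T) (x : T' ⟶ X), (t ≫ g) • x = x) :
    ∀ ⦃T' : C⦄ (t : T' ⟶ T) (x : T' ⟶ X), (t ≫ g⁻¹) • x = x :=
  fun _ t x => by
    calc (t ≫ g⁻¹) • x = (t ≫ g)⁻¹ • ((t ≫ g) • x) := by rw [hg, GrpObj.comp_inv]
      _ = x := inv_smul_smul _ _

/-- **The kernel is a NORMAL subgroup of `G(T)`**: closed under conjugation. [cite: GortzWedhorn2020, Definition 4.44, p. 117] -/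
theorem forall_conj_smul_eq {T : C} {g : T ⟶ G}
    (hg : ∀ ⦃T' : C⦄ (t : T' ⟶ T) (x : T' ⟶ X), (t ≫ g) • x = x) (h : T ⟶ G) :
    ∀ ⦃T' : C⦄ (t : T' ⟶ T) (x : T' ⟶ X), (t ≫ (h * g * h⁻¹)) • x = x :=
  fun _ t x => by
    rw [MonObj.comp_mul, MonObj.comp_mul, GrpObj.comp_inv, mul_smul, mul_smul, hg, smul_inv_smul]

end Grp

end Points

/-! ## §2 Schemes: the kernel of the action is a closed subscheme of `G`, for `X ⟶ S` finite flat and separated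

Base changes of `S`-schemes are Mathlib's: `G ⊗ X = G ×_S X` (`(G ⊗ X).left = pullback G.hom X.hom`, `(fst G X).left =
pullback.fst G.hom X.hom`), and for `g : T ⟶ G` the scheme `pullback (fst G X).left g.left = (G ×_S X) ×_G T` with its
projection `pullback.fst _ _` to `G ×_S X` — the shape in which ★ `ContainmentLocusFiniteFlat` speaks. -/

section Kernel

variable {S : Scheme.{u}} (G X : Over S)

section Mon

variable [MonObj G] [ModObj G X]

/-- **`g` acts trivially iff the projection `(G ×_S X) ×_G T ⟶ G ×_S X` equalises `γ` and `pr₂`** (the `T'`-valued points of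
`(G ×_S X) ×_G T` are the pairs `(⟨t ≫ g, x⟩, t)`). [cite: GortzWedhorn2020, Definition 4.44, p. 117]
[cite: GortzWedhorn2020, Section (4.7) (pp. 107–108)] -/
theorem fst_comp_smul_left_eq_iff_forall_smul_eq {T : Over S} (g : T ⟶ G) :
    pullback.fst (fst G X).left g.left ≫ (γ[G, X]).left =
        pullback.fst (fst G X).left g.left ≫ (snd G X).left ↔
      ∀ ⦃T' : Over S⦄ (t : T' ⟶ T) (x : T' ⟶ X), (t ≫ g) • x = x := by
  constructor
  · intro h T' t x
    -- the `T'`-valued point `(⟨t ≫ g, x⟩, t)` of `(G ×_S X) ×_G T`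
    let w : T'.left ⟶ pullback (fst G X).left g.left :=
      pullback.lift (lift (t ≫ g) x).left t.left (by rw [← Over.comp_left, lift_fst, Over.comp_left])
    have hw : w ≫ pullback.fst (fst G X).left g.left = (lift (t ≫ g) x).left := pullback.lift_fst _ _ _
    ext
    rw [smul_eq_lift_comp, Over.comp_left, ← hw, Category.assoc, h, ← Category.assoc, hw, ← Over.comp_left,
      lift_snd]
  · intro h
    let T' : Over S := Over.mk (pullback.snd (fst G X).left g.left ≫ T.hom)
    let t : T' ⟶ T := Over.homMk (pullback.snd (fst G X).left g.left) rfl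
    have hx : (pullback.fst (fst G X).left g.left ≫ (snd G X).left) ≫ X.hom = T'.hom := by
      change _ = pullback.snd (fst G X).left g.left ≫ T.hom
      rw [Category.assoc, Over.w (snd G X), ← Over.w (fst G X), ← Category.assoc, pullback.condition,
        Category.assoc, Over.w g]
    let x : T' ⟶ X := Over.homMk (pullback.fst (fst G X).left g.left ≫ (snd G X).left) hx
    have hl : (lift (t ≫ g) x).left = pullback.fst (fst G X).left g.left := by
      rw [Over.lift_left]
      apply pullback.hom_ext
      · rw [pullback.lift_fst, Over.comp_left]
        exact (pullback.condition (f := (fst G X).left) (g := g.left)).symm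
      · rw [pullback.lift_snd]
        rfl
    have key := congrArg (fun k => k.left) (h t x)
    simp only [smul_eq_lift_comp, Over.comp_left, hl] at key
    exact key

/-- **Ideal form**: `g` acts trivially iff the ideal sheaf of the universal stabilizer `Eq(γ, pr₂) ⊆ G ×_S X` (a closed
subscheme, `X ⟶ S` separated) dies on `(G ×_S X) ×_G T ⟶ G ×_S X` («`(G ×_S X)_T ⊆ Eq(γ, pr₂)_T` over `G`»).
[cite: GortzWedhorn2020, Definition/Proposition 9.7 (ii)] [cite: MumfordFogartyKirwan1994, Ch. 0 §1, Def. 0.4 (p. 3)] -/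
theorem ker_equalizer_ι_le_ker_fst_iff_forall_smul_eq [IsSeparated X.hom] {T : Over S} (g : T ⟶ G) :
    (equalizer.ι (γ[G, X]) (snd G X)).left.ker ≤ (pullback.fst (fst G X).left g.left).ker ↔
      ∀ ⦃T' : Over S⦄ (t : T' ⟶ T) (x : T' ⟶ X), (t ≫ g) • x = x := by
  rw [← comp_eq_comp_iff_ker_equalizer_ι_le, fst_comp_smul_left_eq_iff_forall_smul_eq]

/-- **THE KERNEL OF THE ACTION IS A CLOSED SUBSCHEME OF `G`** — flavour (ii), any base: if `pr₁ : G ×_S X ⟶ G` is affine with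
finite projective affine charts ([GortzWedhorn2020] Def. 12.18: finite locally free; e.g. `X ⟶ S` finite locally free) and
`X ⟶ S` is separated, there is an ideal sheaf `N` on `G` such that for every `S`-scheme `T` and every `g : T ⟶ G`:
`N ≤ g.left.ker` iff `g` acts trivially on `X_T`, iff `g` factors through the closed subscheme `V(N) ⊆ G`
(★ `ContainmentLocusFiniteFlat` for the closed subscheme `Eq(γ, pr₂) ⊆ G ×_S X` over the base `G`).
[cite: GortzWedhorn2020, Definition 12.18 and Proposition 12.19 (pp. 331–332)]
[cite: MumfordFogartyKirwan1994, Ch. 6 §3 Prop. 6.16 (p. 126)] -/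
theorem exists_idealSheafData_le_ker_iff_forall_smul_eq_of_finite_projective_app [IsAffineHom (fst G X).left]
    (hp : ∀ s : G.left, ∃ W : G.left.Opens, s ∈ W ∧ IsAffineOpen W ∧
      letI := ((fst G X).left.app W).hom.toAlgebra
      Module.Finite Γ(G.left, W) Γ((G ⊗ X).left, (fst G X).left ⁻¹ᵁ W) ∧
        Module.Projective Γ(G.left, W) Γ((G ⊗ X).left, (fst G X).left ⁻¹ᵁ W))
    [IsSeparated X.hom] :
    ∃ N : G.left.IdealSheafData, ∀ ⦃T : Over S⦄ (g : T ⟶ G),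
      (N ≤ g.left.ker ↔ ∀ ⦃T' : Over S⦄ (t : T' ⟶ T) (x : T' ⟶ X), (t ≫ g) • x = x) ∧
      ((∃ g' : T.left ⟶ N.subscheme, g' ≫ N.subschemeι = g.left) ↔ ∀ ⦃T'⦄ (t : T' ⟶ T) (x : T' ⟶ X), (t ≫ g) • x = x) := by
  obtain ⟨N, hN⟩ := exists_idealSheafData_le_ker_iff_le_ker_fst_of_finite_projective_app (fst G X).left
    (equalizer.ι (γ[G, X]) (snd G X)).left.ker hp
  refine ⟨N, fun T g => ?_⟩
  have h1 : N ≤ g.left.ker ↔ ∀ ⦃T' : Over S⦄ (t : T' ⟶ T) (x : T' ⟶ X), (t ≫ g) • x = x := by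
    rw [hN g.left, ker_equalizer_ι_le_ker_fst_iff_forall_smul_eq]
  refine ⟨h1, ?_⟩
  rw [← h1]
  constructor
  · rintro ⟨g', hg'⟩
    rw [← hg']
    exact N.ker_subschemeι.symm.trans_le (Scheme.Hom.le_ker_comp _ _)
  · intro H
    exact ⟨IsClosedImmersion.lift N.subschemeι g.left (by rwa [N.ker_subschemeι]), IsClosedImmersion.lift_fac _ _ _⟩

/-- **THE KERNEL OF THE ACTION IS A CLOSED SUBSCHEME OF `G`** — flavour (i): `X ⟶ S` finite, flat and separated, `G` locally
noetherian.  One ideal sheaf `N` on `G` with `N ≤ g.left.ker ↔ g` acts trivially `↔ g` factors through `V(N)`, for all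
`S`-schemes `T` and all `g : T ⟶ G`. [cite: GortzWedhorn2020, Definition/Proposition 9.7 (ii)]
[cite: MumfordFogartyKirwan1994, Ch. 6 §3 Prop. 6.16 (p. 126)] -/
theorem exists_idealSheafData_le_ker_iff_forall_smul_eq_of_isFinite_of_flat [IsFinite X.hom] [Flat X.hom]
    [IsLocallyNoetherian G.left] [IsSeparated X.hom] :
    ∃ N : G.left.IdealSheafData, ∀ ⦃T : Over S⦄ (g : T ⟶ G),
      (N ≤ g.left.ker ↔ ∀ ⦃T' : Over S⦄ (t : T' ⟶ T) (x : T' ⟶ X), (t ≫ g) • x = x) ∧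
      ((∃ g' : T.left ⟶ N.subscheme, g' ≫ N.subschemeι = g.left) ↔ ∀ ⦃T'⦄ (t : T' ⟶ T) (x : T' ⟶ X), (t ≫ g) • x = x) := by
  haveI : IsFinite (fst G X).left := by rw [Over.fst_left]; infer_instance
  haveI : Flat (fst G X).left := by rw [Over.fst_left]; infer_instance
  exact exists_idealSheafData_le_ker_iff_forall_smul_eq_of_finite_projective_app G X
    (finite_projective_app_of_isFinite_of_flat (fst G X).left)

/-- The same with the locally noetherian hypothesis on the base: `S` locally noetherian and `G ⟶ S` locally of finite type
(Mathlib `LocallyOfFiniteType.isLocallyNoetherian`). [cite: GortzWedhorn2020, Definition/Proposition 9.7 (ii)]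
[cite: MumfordFogartyKirwan1994, Ch. 6 §3 Prop. 6.16 (p. 126)] -/
theorem exists_idealSheafData_le_ker_iff_forall_smul_eq_of_locallyOfFiniteType [IsFinite X.hom] [Flat X.hom]
    [IsLocallyNoetherian S] [LocallyOfFiniteType G.hom] [IsSeparated X.hom] :
    ∃ N : G.left.IdealSheafData, ∀ ⦃T : Over S⦄ (g : T ⟶ G),
      (N ≤ g.left.ker ↔ ∀ ⦃T' : Over S⦄ (t : T' ⟶ T) (x : T' ⟶ X), (t ≫ g) • x = x) ∧
      ((∃ g' : T.left ⟶ N.subscheme, g' ≫ N.subschemeι = g.left) ↔ ∀ ⦃T'⦄ (t : T' ⟶ T) (x : T' ⟶ X), (t ≫ g) • x = x) :=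
  haveI := LocallyOfFiniteType.isLocallyNoetherian G.hom
  exists_idealSheafData_le_ker_iff_forall_smul_eq_of_isFinite_of_flat G X

/-- **The kernel ideal is unique**: two ideal sheaves on `G` representing «acts trivially» coincide
(★ `idealSheafData_eq_of_forall_le_ker_iff`; a bare `b : W ⟶ G.left` is the `S`-morphism `Over.homMk b` out of
`Over.mk (b ≫ G.hom)`). [cite: GortzWedhorn2020, Definition/Proposition 9.7 (ii)] -/
theorem idealSheafData_eq_of_le_ker_iff_forall_smul_eq {N N' : G.left.IdealSheafData}
    (hN : ∀ ⦃T : Over S⦄ (g : T ⟶ G), N ≤ g.left.ker ↔ ∀ ⦃T' : Over S⦄ (t : T' ⟶ T) (x : T' ⟶ X), (t ≫ g) • x = x)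
    (hN' : ∀ ⦃T : Over S⦄ (g : T ⟶ G), N' ≤ g.left.ker ↔ ∀ ⦃T' : Over S⦄ (t : T' ⟶ T) (x : T' ⟶ X), (t ≫ g) • x = x) :
    N = N' :=
  idealSheafData_eq_of_forall_le_ker_iff fun _ b =>
    (hN (Over.homMk b rfl : Over.mk (b ≫ G.hom) ⟶ G)).trans (hN' (Over.homMk b rfl : Over.mk (b ≫ G.hom) ⟶ G)).symm

variable {G X}

/-- The unit section lies in the kernel: `N ≤ 𝓘(1 : T ⟶ G)`. [cite: GortzWedhorn2020, Definition 4.44, p. 117] -/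
theorem le_ker_one_left {N : G.left.IdealSheafData}
    (hN : ∀ ⦃T : Over S⦄ (g : T ⟶ G), N ≤ g.left.ker ↔ ∀ ⦃T' : Over S⦄ (t : T' ⟶ T) (x : T' ⟶ X), (t ≫ g) • x = x)
    (T : Over S) : N ≤ (1 : T ⟶ G).left.ker :=
  (hN 1).2 (forall_one_smul_eq G X T)

/-- **The kernel is closed under the group law** (`N ≤ (·).left.ker` currency). [cite: GortzWedhorn2020, Definition 4.44, p. 117] -/
theorem le_ker_mul_left {N : G.left.IdealSheafData}
    (hN : ∀ ⦃T : Over S⦄ (g : T ⟶ G), N ≤ g.left.ker ↔ ∀ ⦃T' : Over S⦄ (t : T' ⟶ T) (x : T' ⟶ X), (t ≫ g) • x = x)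
    {T : Over S} {g h : T ⟶ G} (hg : N ≤ g.left.ker) (hh : N ≤ h.left.ker) : N ≤ (g * h).left.ker :=
  (hN (g * h)).2 (forall_mul_smul_eq G X ((hN g).1 hg) ((hN h).1 hh))

/-- The kernel is a sub-presheaf: `N ≤ 𝓘(g) ⇒ N ≤ 𝓘(s ≫ g)`. [cite: GortzWedhorn2020, Definition 4.44, p. 117] -/
theorem le_ker_comp_left {N : G.left.IdealSheafData}
    (hN : ∀ ⦃T : Over S⦄ (g : T ⟶ G), N ≤ g.left.ker ↔ ∀ ⦃T' : Over S⦄ (t : T' ⟶ T) (x : T' ⟶ X), (t ≫ g) • x = x)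
    {T T'' : Over S} {g : T ⟶ G} (hg : N ≤ g.left.ker) (s : T'' ⟶ T) : N ≤ (s ≫ g).left.ker :=
  (hN (s ≫ g)).2 (forall_smul_eq_comp G X ((hN g).1 hg) s)

variable (G X) in
/-- **The action is trivial iff the kernel is all of `G`**: `γ = pr₂ ↔ N = ⊥`. [cite: GortzWedhorn2020, Definition 4.44, p. 117] -/
theorem smul_eq_snd_iff_eq_bot {N : G.left.IdealSheafData}
    (hN : ∀ ⦃T : Over S⦄ (g : T ⟶ G), N ≤ g.left.ker ↔ ∀ ⦃T' : Over S⦄ (t : T' ⟶ T) (x : T' ⟶ X), (t ≫ g) • x = x) :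
    γ[G, X] = snd G X ↔ N = ⊥ := by
  rw [smul_eq_snd_iff_forall_smul_eq]
  constructor
  · intro h
    have h1 := (hN (𝟙 G)).2 fun T' t x => h (t ≫ 𝟙 G) x
    rwa [Over.id_left, Scheme.Hom.ker_eq_bot_of_isIso, le_bot_iff] at h1
  · intro h T g x
    have h1 : N ≤ g.left.ker := by rw [h]; exact bot_le
    simpa only [Category.id_comp] using (hN g).1 h1 (𝟙 T) x

end Mon

section Grp

variable {G X} [GrpObj G] [ModObj G X]

variable (G X) in
/-- **`V(N) ⊆ Stab(x)` for every section `x`**: the ideal sheaf of the stabilizer `Stab(x) ⊆ G` (★ `Stabilizer.stabι`, a closed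
immersion for `X ⟶ S` separated) is contained in the kernel ideal `N`. [cite: MumfordFogartyKirwan1994, Ch. 0 §1, Def. 0.4 (p. 3)] -/
theorem ker_stabι_le [IsSeparated X.hom] {N : G.left.IdealSheafData}
    (hN : ∀ ⦃T : Over S⦄ (g : T ⟶ G), N ≤ g.left.ker ↔ ∀ ⦃T' : Over S⦄ (t : T' ⟶ T) (x : T' ⟶ X), (t ≫ g) • x = x)
    (x : 𝟙_ (Over S) ⟶ X) : (stabι G x).left.ker ≤ N := by
  haveI := isClosedImmersion_stabι_left_of_isSeparated G x
  -- the inclusion `V(N) ⟶ G`, as an `S`-morphism, acts trivially, hence stabilizes `x`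
  let V : Over S := Over.mk (N.subschemeι ≫ G.hom)
  let i : V ⟶ G := Over.homMk N.subschemeι rfl
  have hi : ∀ ⦃T' : Over S⦄ (t : T' ⟶ V) (y : T' ⟶ X), (t ≫ i) • y = y :=
    (hN i).1 (by change N ≤ N.subschemeι.ker; rw [N.ker_subschemeι])
  have hfix : i • (toUnit V ≫ x) = toUnit V ≫ x := by
    simpa only [Category.id_comp] using hi (𝟙 V) (toUnit V ≫ x)
  have hfac : (stabLift i hfix).left ≫ (stabι G x).left = N.subschemeι := by
    rw [← Over.comp_left, stabLift_ι]; rfl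
  rw [← N.ker_subschemeι, ← hfac]
  exact Scheme.Hom.le_ker_comp _ _

/-- **The kernel is closed under inverses** (in the `N ≤ (·).left.ker` currency). [cite: GortzWedhorn2020, Definition 4.44, p. 117] -/
theorem le_ker_inv_left {N : G.left.IdealSheafData}
    (hN : ∀ ⦃T : Over S⦄ (g : T ⟶ G), N ≤ g.left.ker ↔ ∀ ⦃T' : Over S⦄ (t : T' ⟶ T) (x : T' ⟶ X), (t ≫ g) • x = x)
    {T : Over S} {g : T ⟶ G} (hg : N ≤ g.left.ker) : N ≤ g⁻¹.left.ker :=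
  (hN g⁻¹).2 (forall_inv_smul_eq G X ((hN g).1 hg))

/-- **The kernel is a NORMAL subgroup functor**: `N ≤ 𝓘(g) ⇒ N ≤ 𝓘(h g h⁻¹)` for every `h : T ⟶ G`.
[cite: GortzWedhorn2020, Definition 4.44, p. 117] -/
theorem le_ker_conj_left {N : G.left.IdealSheafData}
    (hN : ∀ ⦃T : Over S⦄ (g : T ⟶ G), N ≤ g.left.ker ↔ ∀ ⦃T' : Over S⦄ (t : T' ⟶ T) (x : T' ⟶ X), (t ≫ g) • x = x)
    {T : Over S} {g : T ⟶ G} (hg : N ≤ g.left.ker) (h : T ⟶ G) : N ≤ (h * g * h⁻¹).left.ker :=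
  (hN (h * g * h⁻¹)).2 (forall_conj_smul_eq G X ((hN g).1 hg) h)

end Grp

end Kernel

/-! ## §3 The base form: «`G_T` acts trivially on `X_T`» is a closed subscheme of `S` -/

section Base

variable {S : Scheme.{u}}

/-- **`φ_T = ψ_T` on points**: for `S`-morphisms `φ ψ : P ⟶ Y` and `b : T ⟶ S`, the base changes along `b` agree iff
`q ≫ φ = q ≫ ψ` for every `S`-scheme `T'` OVER `T` and every `q : T' ⟶ P` (the `T'`-valued points of `P ×_S T` are the pairs
`(q, t)`; ★ `pullback_map_eq_iff_fst_comp_eq`). [cite: GortzWedhorn2020, Section (4.7) (pp. 107–108)] -/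
theorem pullback_map_eq_iff_forall_comp_eq {P Y : Over S} (φ ψ : P ⟶ Y) {T : Scheme.{u}} (b : T ⟶ S) :
    (Over.pullback b).map φ = (Over.pullback b).map ψ ↔
      ∀ ⦃T' : Over S⦄ (_ : T' ⟶ Over.mk b) (q : T' ⟶ P), q ≫ φ = q ≫ ψ := by
  rw [pullback_map_eq_iff_fst_comp_eq]
  constructor
  · intro h T' t q
    let w : T'.left ⟶ pullback P.hom b := pullback.lift q.left t.left (by rw [Over.w q, ← Over.w t]; rfl)
    have hw : w ≫ pullback.fst P.hom b = q.left := pullback.lift_fst _ _ _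
    ext
    rw [Over.comp_left, Over.comp_left, ← hw, Category.assoc, h, Category.assoc]
  · intro h
    let T' : Over S := Over.mk (pullback.snd P.hom b ≫ b)
    let t : T' ⟶ Over.mk b := Over.homMk (pullback.snd P.hom b) rfl
    let q : T' ⟶ P := Over.homMk (pullback.fst P.hom b) pullback.condition
    exact congrArg (fun k => k.left) (h t q)

variable (G X : Over S)

/-- **«`G_T` ACTS TRIVIALLY ON `X_T`» IS A CLOSED SUBSCHEME OF THE BASE**: for `G ⟶ S` and `X ⟶ S` finite and flat over a
locally noetherian `S`, `X ⟶ S` separated, there is an ideal sheaf `E` on `S` such that for every `b : T ⟶ S`: `E ≤ b.ker`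
iff every `T'`-valued point of `G` acts trivially on every `T'`-valued point of `X` for all `S`-schemes `T'` over `T`, iff `b`
factors through `V(E) ⊆ S` (★ `HomEqualityLocusFiniteFlat` W1 at `γ` versus `pr₂ : G ×_S X ⟶ X`).
[cite: MumfordFogartyKirwan1994, Ch. 6 §3 Prop. 6.16 (p. 126)] [cite: GortzWedhorn2020, Definition/Proposition 9.7 (ii)] -/
theorem exists_idealSheafData_iff_forall_smul_eq_of_isFinite_of_flat [MonObj G] [ModObj G X] [IsFinite G.hom] [Flat G.hom]
    [IsFinite X.hom] [Flat X.hom] [IsLocallyNoetherian S] [IsSeparated X.hom] :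
    ∃ E : S.IdealSheafData, ∀ ⦃T : Scheme.{u}⦄ (b : T ⟶ S),
      (E ≤ b.ker ↔ ∀ ⦃T' : Over S⦄ (_ : T' ⟶ Over.mk b) (g : T' ⟶ G) (x : T' ⟶ X), g • x = x) ∧
      ((∃ b' : T ⟶ E.subscheme, b' ≫ E.subschemeι = b) ↔
        ∀ ⦃T' : Over S⦄ (_ : T' ⟶ Over.mk b) (g : T' ⟶ G) (x : T' ⟶ X), g • x = x) := by
  haveI : IsFinite (G ⊗ X).hom := by rw [Over.tensorObj_hom]; infer_instance
  haveI : Flat (G ⊗ X).hom := by rw [Over.tensorObj_hom]; infer_instance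
  obtain ⟨E, hE⟩ := exists_idealSheafData_iff_pullback_map_eq_of_isFinite_of_flat (γ[G, X]) (snd G X)
  have hpts : ∀ ⦃T : Scheme.{u}⦄ (b : T ⟶ S),
      (Over.pullback b).map (γ[G, X]) = (Over.pullback b).map (snd G X) ↔
        ∀ ⦃T' : Over S⦄ (_ : T' ⟶ Over.mk b) (g : T' ⟶ G) (x : T' ⟶ X), g • x = x := fun T b => by
    rw [pullback_map_eq_iff_forall_comp_eq]
    constructor
    · intro h T' t g x
      rw [smul_eq_lift_comp, h t (lift g x), lift_snd]
    · intro h T' t q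
      have hq : lift (q ≫ fst G X) (q ≫ snd G X) = q := by
        apply CartesianMonoidalCategory.hom_ext <;> simp
      have h1 := h t (q ≫ fst G X) (q ≫ snd G X)
      rw [smul_eq_lift_comp, hq] at h1
      exact h1
  exact ⟨E, fun T b => ⟨(hE b).2.trans (hpts b), (hE b).1.trans (hpts b)⟩⟩

end Base

end Literature.AlgebraicGeometry.GroupSchemes

end
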